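import Mathlib
import Summits.Ventures.PercRepro2.UnionRowMech2

/-!
# The two-status union row from conditional positive association — the residual patterns, I
(blind cell PercRepro2, mine-1 g40; proofs/MINE1-UNIONROW2.md §8)

`UnionRowMech2.double_exclusion_nonneg` proved the double-exclusion union row of row 2′CON-U
(`X = Y = {u, v}`; both double-hit cells `(S, T)`, `(T, S)` cut from the covariance sum) for
up-set indicators `A, B` in every membership pattern of the two double-hit cells EXCEPT the two
residual ones — `(S, T) ∈ A ∩ B` with `(T, S) ∉ A ∪ B`, and its mirror. This file and its two
companions `UnionRowMech4` (the ten cases), `UnionRowMech5` (the mirror, and the theorem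
`double_exclusion_nonneg_all`) close them.

An up-set `A` with `(S, T) ∈ A`, `(T, S) ∉ A` is `{u = S} ∪ {u = N, v ≥ c}` for a threshold
`c ∈ {0, 1, 2, 3}` (`resUp c`; `eq_resUp_of_up`) — FOUR thresholds, `c = 0` being
`A = {u ≠ T}`. For `A = resUp cA ⊆ B = resUp cB` (`cB ≤ cA`), `P = M(A)`, `Q = M(B)`,
`σ = M(S,T)`, `σ′ = M(T,S)`, the row reads

  `E = Z·(Z·P − P·Q) − σ·(Z − P)(Z − Q) − σ′·P·Q`,

and THREE mechanisms close it, each from ONE instance of positive association inside an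
avoidance set (the hypotheses `hRu`: up-sets inside `{u ≠ T}` = `t ↮ {s, u}`, and `hR′`:
down-sets inside `{u ≠ S}` = `s ↮ {t, u}`):

* (G) `cA ≤ 2` (`(N, S) ∈ A`): `hR′` on `Bᶜ` and `{u ≠ S, v < cA}` gives
  `σ′·Q ≤ P·(Z − Q)`, and `E = (P − σ)(Z − P)(Z − Q) + P·(P·(Z − Q) − σ′·Q) ≥ 0`
  (`patG`);
* (H) `cA = 3`, `cB ≥ 1` (`A = {u = S}`, `(N, T) ∉ B`): `hRu` on `{u = S}` and
  `{u ≠ T, v ≥ cB}` gives `(Q − P)·P ≤ (P − σ)(Z − P)`, and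
  `E = (Z − Q)·((P − σ)(Z − P) − (Q − P)·P) + (Z − Q − σ′)·P·Q ≥ 0` (`patH`);
* (K) `cA = 3`, `cB = 0` (`A = {u = S}`, `B = {u ≠ T}`): `hRu` on `{u = S}`, `{u ≠ T, v ≠ T}`
  and `hR′` on `{u = T}`, `{u ≠ S, v ≠ S}` give `a·(M(N,N) + M(N,S)) ≤ ā·n` and
  `τ·(M(N,T) + M(N,N)) ≤ τ̄·n`, whence `E ≥ a·τ·M(N,N) ≥ 0` (`patK`).

This file: the explicit sets, their cell-by-cell masses, and the structure lemma. `UnionRowMech4`: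
the three mechanisms as real arithmetic and the cases (G); `UnionRowMech5`: the cases (H), (K),
the theorem `residual_ii`, its mirror `residual_iii`, and `double_exclusion_nonneg_all`.
-/

namespace Summit.Ventures.PercRepro2

namespace UnionRowMech

open Finset

/-- The residual up-sets `{u = S} ∪ {u = N, v ≥ c}` (`c = 3`: `{u = S}`; `c = 0`: `{u ≠ T}`). -/
def resUp (c : ℕ) : Finset Grid :=
  Finset.univ.filter (fun k => k.1 = 2 ∨ (k.1 = 1 ∧ c ≤ (k.2 : ℕ)))

/-- The cells `{u ≠ T, v ≥ c}`: an up-set inside `Ru`. -/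
def Cset (c : ℕ) : Finset Grid := Finset.univ.filter (fun k => k.1 ≠ 0 ∧ c ≤ (k.2 : ℕ))

/-- The cells `{u ≠ S, v < c}`: a down-set inside `R′`. -/
def Dset (c : ℕ) : Finset Grid := Finset.univ.filter (fun k => k.1 ≠ 2 ∧ (k.2 : ℕ) < c)

/-- The row `{u = T}`: a down-set inside `R′`. -/
def rowT : Finset Grid := Finset.univ.filter (fun k => k.1 = 0)

/-- `resUp c` is an up-set. -/
lemma isUp_resUp : ∀ c : ℕ, c ≤ 3 → IsUp (resUp c) := by
  intro c hc
  unfold IsUp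
  interval_cases c <;> decide

/-- `Cset c` is an up-set. -/
lemma isUp_Cset : ∀ c : ℕ, c ≤ 3 → IsUp (Cset c) := by
  intro c hc
  unfold IsUp
  interval_cases c <;> decide

/-- `Dset c` is a down-set. -/
lemma isDown_Dset : ∀ c : ℕ, c ≤ 3 → IsDown (Dset c) := by
  intro c hc
  unfold IsDown
  interval_cases c <;> decide

/-- `{u = T}` is a down-set. -/
lemma isDown_rowT : IsDown rowT := by
  unfold IsDown
  decide

/-- `resUp c ⊆ {u ≠ T}`. -/
lemma resUp_subset_Ru (c : ℕ) : resUp c ⊆ Ru := by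
  intro k hk
  simp only [resUp, Ru, Finset.mem_filter, Finset.mem_univ, true_and] at hk ⊢
  omega

/-- `Cset c ⊆ {u ≠ T}`. -/
lemma Cset_subset_Ru (c : ℕ) : Cset c ⊆ Ru := by
  intro k hk
  simp only [Cset, Ru, Finset.mem_filter, Finset.mem_univ, true_and] at hk ⊢
  exact hk.1

/-- `Dset c ⊆ {u ≠ S}`. -/
lemma Dset_subset_R' (c : ℕ) : Dset c ⊆ R' := by
  intro k hk
  simp only [Dset, R', Finset.mem_filter, Finset.mem_univ, true_and] at hk ⊢
  exact hk.1

/-- `{u = T} ⊆ {u ≠ S}`. -/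
lemma rowT_subset_R' : rowT ⊆ R' := by
  intro k hk
  simp only [rowT, R', Finset.mem_filter, Finset.mem_univ, true_and] at hk ⊢
  omega

/-- The complement of `resUp c` lies inside `{u ≠ S}`. -/
lemma compl_resUp_subset_R' (c : ℕ) : Finset.univ \ resUp c ⊆ R' := by
  intro k hk
  simp only [resUp, R', Finset.mem_sdiff, Finset.mem_filter, Finset.mem_univ, true_and] at hk ⊢
  omega

/-- The structure of a residual up-set: `(S, T) ∈ A`, `(T, S) ∉ A` force `A = resUp c`. -/
lemma eq_resUp_of_up {A : Finset Grid} (hA : IsUp A) (h1 : ST ∈ A) (h2 : TS ∉ A) :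
    ∃ c : ℕ, c ≤ 3 ∧ A = resUp c := by
  have hS : ∀ j : Fin 3, ((2 : Fin 3), j) ∈ A := fun j => hA (ST_le_of_fst_eq_two _ rfl) h1
  have hT : ∀ j : Fin 3, ((0 : Fin 3), j) ∉ A :=
    fun j hj => h2 (hA (le_TS_of_fst_eq_zero _ rfl) hj)
  have h01 : ((1 : Fin 3), (0 : Fin 3)) ∈ A → ((1 : Fin 3), (1 : Fin 3)) ∈ A :=
    fun h => hA (by decide) h
  have h12 : ((1 : Fin 3), (1 : Fin 3)) ∈ A → ((1 : Fin 3), (2 : Fin 3)) ∈ A :=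
    fun h => hA (by decide) h
  by_cases ha : ((1 : Fin 3), (0 : Fin 3)) ∈ A
  · refine ⟨0, by norm_num, ?_⟩
    have hb := h01 ha
    have hc := h12 hb
    ext ⟨i, j⟩
    fin_cases i <;> fin_cases j <;> simp [resUp, hS, hT, ha, hb, hc]
  · by_cases hb : ((1 : Fin 3), (1 : Fin 3)) ∈ A
    · refine ⟨1, by norm_num, ?_⟩
      have hc := h12 hb
      ext ⟨i, j⟩
      fin_cases i <;> fin_cases j <;> simp [resUp, hS, hT, ha, hb, hc]
    · by_cases hc : ((1 : Fin 3), (2 : Fin 3)) ∈ A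
      · refine ⟨2, by norm_num, ?_⟩
        ext ⟨i, j⟩
        fin_cases i <;> fin_cases j <;> simp [resUp, hS, hT, ha, hb, hc]
      · refine ⟨3, le_rfl, ?_⟩
        ext ⟨i, j⟩
        fin_cases i <;> fin_cases j <;> simp [resUp, hS, hT, ha, hb, hc]

variable {M : Grid → ℝ}

/-- The total mass, cell by cell. -/
lemma total_expand : total M = M (0,0) + M (0,1) + M (0,2) + M (1,0) + M (1,1) + M (1,2) +
    M (2,0) + M (2,1) + M (2,2) := by
  unfold total
  rw [Fintype.sum_prod_type]
  simp only [Fin.sum_univ_three]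
  ring

/-- The mass of an explicit filter set, cell by cell. -/
lemma mass_filter_expand (p : Grid → Prop) [DecidablePred p] :
    mass M (Finset.univ.filter p) =
      (if p (0,0) then M (0,0) else 0) + (if p (0,1) then M (0,1) else 0) +
      (if p (0,2) then M (0,2) else 0) + (if p (1,0) then M (1,0) else 0) +
      (if p (1,1) then M (1,1) else 0) + (if p (1,2) then M (1,2) else 0) +
      (if p (2,0) then M (2,0) else 0) + (if p (2,1) then M (2,1) else 0) +
      (if p (2,2) then M (2,2) else 0) := by
  unfold mass
  rw [Finset.sum_filter, Fintype.sum_prod_type]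
  simp only [Fin.sum_univ_three]
  ring

/-! ### The masses of the explicit sets -/

/-- The mass of `resUp 0`, cell by cell. -/
lemma mass_resUp_0 : mass M (resUp 0) = M (1,0) + M (1,1) + M (1,2) + M (2,0) + M (2,1) + M (2,2) := by
  rw [show (resUp 0 : Finset Grid) = Finset.univ.filter (fun k : Grid => k = (1,0) ∨ k = (1,1) ∨ k = (1,2) ∨ k = (2,0) ∨ k = (2,1) ∨ k = (2,2)) from by decide,
    mass_filter_expand]
  simp

/-- The mass of `resUp 1`, cell by cell. -/
lemma mass_resUp_1 : mass M (resUp 1) = M (1,1) + M (1,2) + M (2,0) + M (2,1) + M (2,2) := by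
  rw [show (resUp 1 : Finset Grid) = Finset.univ.filter (fun k : Grid => k = (1,1) ∨ k = (1,2) ∨ k = (2,0) ∨ k = (2,1) ∨ k = (2,2)) from by decide,
    mass_filter_expand]
  simp

/-- The mass of `resUp 2`, cell by cell. -/
lemma mass_resUp_2 : mass M (resUp 2) = M (1,2) + M (2,0) + M (2,1) + M (2,2) := by
  rw [show (resUp 2 : Finset Grid) = Finset.univ.filter (fun k : Grid => k = (1,2) ∨ k = (2,0) ∨ k = (2,1) ∨ k = (2,2)) from by decide,
    mass_filter_expand]
  simp

/-- The mass of `resUp 3`, cell by cell. -/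
lemma mass_resUp_3 : mass M (resUp 3) = M (2,0) + M (2,1) + M (2,2) := by
  rw [show (resUp 3 : Finset Grid) = Finset.univ.filter (fun k : Grid => k = (2,0) ∨ k = (2,1) ∨ k = (2,2)) from by decide,
    mass_filter_expand]
  simp

/-- The mass of `Finset.univ \ resUp 0`, cell by cell. -/
lemma mass_compl_resUp_0 : mass M (Finset.univ \ resUp 0) = M (0,0) + M (0,1) + M (0,2) := by
  rw [show (Finset.univ \ resUp 0 : Finset Grid) = Finset.univ.filter (fun k : Grid => k = (0,0) ∨ k = (0,1) ∨ k = (0,2)) from by decide,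
    mass_filter_expand]
  simp

/-- The mass of `Finset.univ \ resUp 1`, cell by cell. -/
lemma mass_compl_resUp_1 : mass M (Finset.univ \ resUp 1) = M (0,0) + M (0,1) + M (0,2) + M (1,0) := by
  rw [show (Finset.univ \ resUp 1 : Finset Grid) = Finset.univ.filter (fun k : Grid => k = (0,0) ∨ k = (0,1) ∨ k = (0,2) ∨ k = (1,0)) from by decide,
    mass_filter_expand]
  simp

/-- The mass of `Finset.univ \ resUp 2`, cell by cell. -/
lemma mass_compl_resUp_2 : mass M (Finset.univ \ resUp 2) = M (0,0) + M (0,1) + M (0,2) + M (1,0) + M (1,1) := by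
  rw [show (Finset.univ \ resUp 2 : Finset Grid) = Finset.univ.filter (fun k : Grid => k = (0,0) ∨ k = (0,1) ∨ k = (0,2) ∨ k = (1,0) ∨ k = (1,1)) from by decide,
    mass_filter_expand]
  simp

/-- The mass of `Finset.univ \ resUp 3`, cell by cell. -/
lemma mass_compl_resUp_3 : mass M (Finset.univ \ resUp 3) = M (0,0) + M (0,1) + M (0,2) + M (1,0) + M (1,1) + M (1,2) := by
  rw [show (Finset.univ \ resUp 3 : Finset Grid) = Finset.univ.filter (fun k : Grid => k = (0,0) ∨ k = (0,1) ∨ k = (0,2) ∨ k = (1,0) ∨ k = (1,1) ∨ k = (1,2)) from by decide,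
    mass_filter_expand]
  simp

/-- The mass of `Cset 0`, cell by cell. -/
lemma mass_Cset_0 : mass M (Cset 0) = M (1,0) + M (1,1) + M (1,2) + M (2,0) + M (2,1) + M (2,2) := by
  rw [show (Cset 0 : Finset Grid) = Finset.univ.filter (fun k : Grid => k = (1,0) ∨ k = (1,1) ∨ k = (1,2) ∨ k = (2,0) ∨ k = (2,1) ∨ k = (2,2)) from by decide,
    mass_filter_expand]
  simp

/-- The mass of `Cset 1`, cell by cell. -/
lemma mass_Cset_1 : mass M (Cset 1) = M (1,1) + M (1,2) + M (2,1) + M (2,2) := by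
  rw [show (Cset 1 : Finset Grid) = Finset.univ.filter (fun k : Grid => k = (1,1) ∨ k = (1,2) ∨ k = (2,1) ∨ k = (2,2)) from by decide,
    mass_filter_expand]
  simp

/-- The mass of `Cset 2`, cell by cell. -/
lemma mass_Cset_2 : mass M (Cset 2) = M (1,2) + M (2,2) := by
  rw [show (Cset 2 : Finset Grid) = Finset.univ.filter (fun k : Grid => k = (1,2) ∨ k = (2,2)) from by decide,
    mass_filter_expand]
  simp

/-- The mass of `Cset 3`, cell by cell. -/
lemma mass_Cset_3 : mass M (Cset 3) = 0 := by
  rw [show (Cset 3 : Finset Grid) = Finset.univ.filter (fun k : Grid => False) from by decide,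
    mass_filter_expand]
  simp

/-- The mass of `Dset 0`, cell by cell. -/
lemma mass_Dset_0 : mass M (Dset 0) = 0 := by
  rw [show (Dset 0 : Finset Grid) = Finset.univ.filter (fun k : Grid => False) from by decide,
    mass_filter_expand]
  simp

/-- The mass of `Dset 1`, cell by cell. -/
lemma mass_Dset_1 : mass M (Dset 1) = M (0,0) + M (1,0) := by
  rw [show (Dset 1 : Finset Grid) = Finset.univ.filter (fun k : Grid => k = (0,0) ∨ k = (1,0)) from by decide,
    mass_filter_expand]
  simp

/-- The mass of `Dset 2`, cell by cell. -/
lemma mass_Dset_2 : mass M (Dset 2) = M (0,0) + M (0,1) + M (1,0) + M (1,1) := by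
  rw [show (Dset 2 : Finset Grid) = Finset.univ.filter (fun k : Grid => k = (0,0) ∨ k = (0,1) ∨ k = (1,0) ∨ k = (1,1)) from by decide,
    mass_filter_expand]
  simp

/-- The mass of `rowT`, cell by cell. -/
lemma mass_rowT : mass M (rowT) = M (0,0) + M (0,1) + M (0,2) := by
  rw [show (rowT : Finset Grid) = Finset.univ.filter (fun k : Grid => k = (0,0) ∨ k = (0,1) ∨ k = (0,2)) from by decide,
    mass_filter_expand]
  simp

/-- The mass of `Ru`, cell by cell. -/
lemma mass_Ru_expand : mass M (Ru) = M (1,0) + M (1,1) + M (1,2) + M (2,0) + M (2,1) + M (2,2) := by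
  rw [show (Ru : Finset Grid) = Finset.univ.filter (fun k : Grid => k = (1,0) ∨ k = (1,1) ∨ k = (1,2) ∨ k = (2,0) ∨ k = (2,1) ∨ k = (2,2)) from by decide,
    mass_filter_expand]
  simp

/-- The mass of `R'`, cell by cell. -/
lemma mass_R'_expand : mass M (R') = M (0,0) + M (0,1) + M (0,2) + M (1,0) + M (1,1) + M (1,2) := by
  rw [show (R' : Finset Grid) = Finset.univ.filter (fun k : Grid => k = (0,0) ∨ k = (0,1) ∨ k = (0,2) ∨ k = (1,0) ∨ k = (1,1) ∨ k = (1,2)) from by decide,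
    mass_filter_expand]
  simp

/-- The mass of `(Finset.univ \ resUp 0) ∩ Dset 0`, cell by cell. -/
lemma mass_inter_G_0_0 : mass M ((Finset.univ \ resUp 0) ∩ Dset 0) = 0 := by
  rw [show ((Finset.univ \ resUp 0) ∩ Dset 0 : Finset Grid) = Finset.univ.filter (fun k : Grid => False) from by decide,
    mass_filter_expand]
  simp

/-- The mass of `(Finset.univ \ resUp 0) ∩ Dset 1`, cell by cell. -/
lemma mass_inter_G_1_0 : mass M ((Finset.univ \ resUp 0) ∩ Dset 1) = M (0,0) := by
  rw [show ((Finset.univ \ resUp 0) ∩ Dset 1 : Finset Grid) = Finset.univ.filter (fun k : Grid => k = (0,0)) from by decide,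
    mass_filter_expand]
  simp

/-- The mass of `(Finset.univ \ resUp 1) ∩ Dset 1`, cell by cell. -/
lemma mass_inter_G_1_1 : mass M ((Finset.univ \ resUp 1) ∩ Dset 1) = M (0,0) + M (1,0) := by
  rw [show ((Finset.univ \ resUp 1) ∩ Dset 1 : Finset Grid) = Finset.univ.filter (fun k : Grid => k = (0,0) ∨ k = (1,0)) from by decide,
    mass_filter_expand]
  simp

/-- The mass of `(Finset.univ \ resUp 0) ∩ Dset 2`, cell by cell. -/
lemma mass_inter_G_2_0 : mass M ((Finset.univ \ resUp 0) ∩ Dset 2) = M (0,0) + M (0,1) := by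
  rw [show ((Finset.univ \ resUp 0) ∩ Dset 2 : Finset Grid) = Finset.univ.filter (fun k : Grid => k = (0,0) ∨ k = (0,1)) from by decide,
    mass_filter_expand]
  simp

/-- The mass of `(Finset.univ \ resUp 1) ∩ Dset 2`, cell by cell. -/
lemma mass_inter_G_2_1 : mass M ((Finset.univ \ resUp 1) ∩ Dset 2) = M (0,0) + M (0,1) + M (1,0) := by
  rw [show ((Finset.univ \ resUp 1) ∩ Dset 2 : Finset Grid) = Finset.univ.filter (fun k : Grid => k = (0,0) ∨ k = (0,1) ∨ k = (1,0)) from by decide,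
    mass_filter_expand]
  simp

/-- The mass of `(Finset.univ \ resUp 2) ∩ Dset 2`, cell by cell. -/
lemma mass_inter_G_2_2 : mass M ((Finset.univ \ resUp 2) ∩ Dset 2) = M (0,0) + M (0,1) + M (1,0) + M (1,1) := by
  rw [show ((Finset.univ \ resUp 2) ∩ Dset 2 : Finset Grid) = Finset.univ.filter (fun k : Grid => k = (0,0) ∨ k = (0,1) ∨ k = (1,0) ∨ k = (1,1)) from by decide,
    mass_filter_expand]
  simp

/-- The mass of `resUp 3 ∩ Cset 1`, cell by cell. -/
lemma mass_inter_H_1 : mass M (resUp 3 ∩ Cset 1) = M (2,1) + M (2,2) := by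
  rw [show (resUp 3 ∩ Cset 1 : Finset Grid) = Finset.univ.filter (fun k : Grid => k = (2,1) ∨ k = (2,2)) from by decide,
    mass_filter_expand]
  simp

/-- The mass of `resUp 3 ∩ Cset 2`, cell by cell. -/
lemma mass_inter_H_2 : mass M (resUp 3 ∩ Cset 2) = M (2,2) := by
  rw [show (resUp 3 ∩ Cset 2 : Finset Grid) = Finset.univ.filter (fun k : Grid => k = (2,2)) from by decide,
    mass_filter_expand]
  simp

/-- The mass of `resUp 3 ∩ Cset 3`, cell by cell. -/
lemma mass_inter_H_3 : mass M (resUp 3 ∩ Cset 3) = 0 := by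
  rw [show (resUp 3 ∩ Cset 3 : Finset Grid) = Finset.univ.filter (fun k : Grid => False) from by decide,
    mass_filter_expand]
  simp

/-- The mass of `rowT ∩ Dset 2`, cell by cell. -/
lemma mass_inter_K2 : mass M (rowT ∩ Dset 2) = M (0,0) + M (0,1) := by
  rw [show (rowT ∩ Dset 2 : Finset Grid) = Finset.univ.filter (fun k : Grid => k = (0,0) ∨ k = (0,1)) from by decide,
    mass_filter_expand]
  simp

/-- `resUp` is antitone in the threshold. -/
lemma resUp_subset_resUp {cA cB : ℕ} (h : cB ≤ cA) : resUp cA ⊆ resUp cB := by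
  intro k hk
  simp only [resUp, Finset.mem_filter, Finset.mem_univ, true_and] at hk ⊢
  omega

end UnionRowMech

end Summit.Ventures.PercRepro2
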